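import Summits.QuantumFields.BalabanUV.Beta.GAN24.LayerCount
import Summits.QuantumFields.BalabanUV.Beta.GAN24.LayerTransportBiLoc
import Summits.QuantumFields.BalabanUV.Beta.GAN24.DressedLegEnvelope
import Literature.MathematicalPhysics.QuantumFieldTheory.Balaban1983to89.T4GaugeActionRatePair

/-!
# `BalabanUV.Beta.GAN24.LayerTransportDepthZero` — binder row G-an2-4 ∕ (CONV-C), W-slot CT-W, route «WC-TL» ∕ (Q-R) «QR-LL», row **(LT-Δ) «LAYER TRANSPORT»**:
# **THE LAYER BOUND `hLT` AT DEPTH ZERO HOLDS FOR EVERY SUB-LETTER, FOR ANY LEGS UNDER BLOCK ENVELOPES — NO GAUGE CELL, NO MOMENT ROW** (the last transported level of the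
# OWNER gan24-p1's ENDs `WardRemainderEndThreeSplit.wLocStencil_unitS_split_three` (p329621) ∕ `WardRemainderEndThreeCoDress` (g30 INTENT 1): at `k = 0` the relative blocking
# `L = Lc^(0+1)` is a CONSTANT, so the crude weighted entry estimate of the three-leg push (leaf-01 g63 `LayerPushEntry`) with the one-block layer count (leaf-01 g63
# `LayerCount.layerCount_block`) IS the displayed `hLT` with a level-free `K` — for the DRESSED literal legs by leaf-12's block envelope `DressedLegEnvelope.exists_legChain_envelope`
# at `(m+1, 0)`, uniformly in `m`; hence the good set `G` of the (Q-R)^{cc} re-cut contains `{(m, v) : m + 2 = n}` for EVERY sub-label `v`)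

NOT IN PRINT; OUR BOOKKEEPING ([folklore] composition BY NAME; G-an2-4 formalisation swarm, leaf prover `b2b-balaban-gan24-formalise-leaf-01`, gen 68).  HONEST FRAMING (cell
contract, verbatim): «discharging `BetaPertH` makes Bałaban's UV stability UNCONDITIONAL — a real constructive-QFT result; it is NOT the continuum limit and NOT the Clay problem.»
HONEST DEPENDENCY (verbatim): «continuum YM on T⁴ ⇐ BetaPertH ∧ nine spine estimates (0/9 proved); BetaPertH ⇐ (D1) ∧ (D4) ∧ CAP+tail; G-an2-4 gates asym, D1 and NE2/3/4.»

## What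
§1 two scalar facts: `exp_supNorm_le_exp_l1` (a block envelope at sup-rate `κ₀` dominates the `ℓ¹`-rate-`κ` one when `(d+1)κ ≤ κ₀`; `‖v‖₁ ≤ (d+1)‖v‖∞` is lit-balaban's
   `T4GaugeActionRatePair.l1_le_mul_supNorm` BY NAME), `min_rate_eq` (`0 < κ < m′ ⇒ min (κ∕4) (min κ (m′∕2)) = κ∕4`).
§2 **`biLoc_smul_push₃_block`** (generic `d`, any relative blocking `N ≥ 1`, GENERIC legs): kernel legs and table leg under COARSE sup-envelopes `C·e^{−κ‖quo N · − ·‖₁}` (no power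
   of `N`, no gradient, no second difference), the letter under the (LAY) profile row `|S κ′ u x z a b| ≤ Cs·ω u·e^{−m′(‖x−u‖₁+‖z−u‖₁)}` with `ω` dominated by the face weight of the
   ONE `N`-block of label `y` (the END's `hS ∕ hω` rows VERBATIM) ⟹ for every scalar `c` and every output slot `(ν, U)`,
   `BiLoc (c • push₃ l r w S ν U) U U (|c|·(d+1)³·Cl·Cr·Cw·Cs·Zl(m′∕2)²·(2(d+1))²·Zl(δ∕2)·N^d·e^{η}·e^{−η‖y − U‖₁}) (κ∕4)`, `η = min (κ∕2) (δ∕2)` — `LayerPushEntry.abs_push₃_inl_inl_le_weighted`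
   ⨾ `LayerCount.layerCount_block` ⨾ `LayerTransportBiLoc.biLoc_of_isFF`.  No charge row, no moment row, no (N1′)∕(N1″).
§3 **`exists_hLT_literal_depth_zero`** (`d = 3`, `2 ≤ Lc`, in-block root `toSite rr`): there are `κ₀′ > 0` and `K′ ≥ 0` (leaf-12's, level-free) such that for every `m`, every
   `0 < κ ≤ κ₀′`, every letter `S` meeting the (LAY) rows `hS ∕ hω` of the END at blocking `Lc^(0+1)` and block label `y` (`κ < m′`, `0 < δ`, `0 ≤ Cs`), and every output slot,
   the DRESSED cubic push at depth zero satisfies the END's `hLT` at `k = 0` TOKEN-EXACTLY: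
   `BiLoc ((Lc^(0+1))^{3(3+1)} • push₃ T₀ T₀ T₀ S ν U) U U ((K′·Cs·Zl(m′∕2)²·Zl(δ∕2)·e^{η}) · ((√(Lc^(0+1)))⁻¹·e^{−η‖y − U‖₁})) (κ∕4)`, `T₀ = legChain (respStepBmSeq ρ Lc) (m+1) 0`.
READING (for `WardRemainderEndThreeCoDress`): the good set may always contain the last transported level, `G m v ⊇ (m + 2 = n)`, for EVERY `v ∈ box Lc` — good or bad label class —
with NO K-LL-4′ display: at depth zero there is no large parameter.  This file says NOTHING about depths `k ≥ 1` (there the per-sub-letter `hLT` for the dressed literal at `d = 3`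
is NEGATIVE-BY-COUNT, RULING R-gan24p1-g29-2).  [folklore]; 0 cited facts, 0 `def`, 0 `def … : Prop`, 0 sorry.  NOTHING of (Q-R)∕(LT)∕(LAY)∕(S)∕(DIV)∕(DL) discharged beyond the
depth-zero instance; NEVER «G-an2-4 closed» as (CONV-C); NOT D1, NOT `BetaPertH`, NOT continuum, NOT Clay.  2026-08-22; no existing file touched.
-/

noncomputable section

open Finset
open scoped BigOperators
open Literature.MathematicalPhysics.QuantumFieldTheory
open Literature.MathematicalPhysics.QuantumFieldTheory.Balaban1983to89
open Literature.MathematicalPhysics.QuantumFieldTheory.Balaban1983to89.Beta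
open B12Sec2to5 (l1 l1_nonneg)
open B4ContourShift (supNorm supNorm_nonneg)
open Literature.MathematicalPhysics.QuantumFieldTheory.Balaban1983to89.T4GaugeActionRatePair (l1_le_mul_supNorm)
open B6BondElimination (unitVec)
open ExpKernelCalculus (MKer Site BiLoc Zl Zl_nonneg)
open OneStepResolventKernel (Fib)
open LatticeForm (quo)
open AffineAveraging (box toSite)
open StepJetData (biLoc_weaken)
open Summit.QuantumFields.BalabanUV.Beta.GAN24.Push4 (IsFF)
open Summit.QuantumFields.BalabanUV.Beta.GAN24.Push4Iter (legChain)
open Summit.QuantumFields.BalabanUV.Beta.GAN24.Push3 (push₃ isFF_push₃)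
open Summit.QuantumFields.BalabanUV.Beta.GAN24.RespStepBmDecompExact (respStepBmSeq)
open Summit.QuantumFields.BalabanUV.Beta.GAN24.LayerPushEntry (abs_push₃_inl_inl_le_weighted)
open Summit.QuantumFields.BalabanUV.Beta.GAN24.LayerCount (layerCount_block card_faces_le)
open Summit.QuantumFields.BalabanUV.Beta.GAN24.LayerTransportBiLoc (biLoc_of_isFF)
open Summit.QuantumFields.BalabanUV.Beta.GAN24.DressedLegEnvelope (exists_legChain_envelope)

namespace Summit.QuantumFields.BalabanUV.Beta.GAN24.LayerTransportDepthZero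

variable {d : ℕ}

/-! ## §1 Two scalar facts -/

/-- [folklore] A block envelope at sup-rate `κ₀` dominates the `ℓ¹`-rate-`κ` envelope as soon as `(d+1)·κ ≤ κ₀` (`0 ≤ κ`). -/
theorem exp_supNorm_le_exp_l1 {κ₀ κ : ℝ} (hκ : 0 ≤ κ) (h : ((d : ℝ) + 1) * κ ≤ κ₀) (v : Fin (d + 1) → ℤ) :
    Real.exp (-(κ₀ * supNorm v)) ≤ Real.exp (-κ * l1 v) := by
  rw [Real.exp_le_exp]
  have h1 := l1_le_mul_supNorm v
  have h2 := supNorm_nonneg v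
  nlinarith [mul_le_mul_of_nonneg_right h h2, mul_le_mul_of_nonneg_left h1 hκ]

/-- [folklore] `0 < κ < m′ ⇒ min (κ∕4) (min κ (m′∕2)) = κ∕4` — the rate bookkeeping of `LayerPushEntry.abs_push₃_inl_inl_le_weighted` under the END's `κ < m′`. -/
theorem min_rate_eq {κ m' : ℝ} (hκ : 0 < κ) (hm : κ < m') : min (κ / 4) (min κ (m' / 2)) = κ / 4 :=
  min_eq_left (le_min (by linarith) (by linarith))

/-! ## §2 The crude block bound of the three-leg push in `BiLoc` currency (generic `d`, generic legs) -/

section Block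

variable {l r w : Fin (d + 1) → (Fin (d + 1) → ℤ) → Fin (d + 1) → (Fin (d + 1) → ℤ) → ℝ}
  {S : Fin (d + 1) → (Fin (d + 1) → ℤ) → MKer (d + 1) (Fib d)} {ω : (Fin (d + 1) → ℤ) → ℝ}
  {N : ℕ} {Cl Cr Cw Cs κ m' δ : ℝ}

/-- NOT IN PRINT; OUR BOOKKEEPING (`LayerPushEntry.abs_push₃_inl_inl_le_weighted` ⨾ `LayerCount.layerCount_block` ⨾ `LayerTransportBiLoc.biLoc_of_isFF`).  **THE CRUDE BLOCK BOUND**: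
generic `d`, relative blocking `N ≥ 1`; kernel legs `|l α x′ κ₁ x| ≤ Cl·e^{−κ‖quo N x − x′‖₁}`, `|r β z′ κ₂ z| ≤ Cr·e^{−κ‖quo N z − z′‖₁}`, table leg `|w ν U κ′ u| ≤ Cw·e^{−κ‖quo N u − U‖₁}`
(sup-envelopes only), the letter under the (LAY) rows — profile `|S κ′ u x z a b| ≤ Cs·ω u·e^{−m′(‖x−u‖₁+‖z−u‖₁)}` (`0 < κ < m′`) and `ω` dominated by the face weight (rate `δ > 0`) of the ONE
`N`-block of label `y` — then for every scalar `c` and every output slot `(ν, U)`: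
`BiLoc (c • push₃ l r w S ν U) U U (|c|·((d+1)³·Cl·Cr·Cw·Cs·Zl(m′∕2)²)·((2(d+1))²·Zl(δ∕2)·N^d·e^{η})·e^{−η‖y − U‖₁}) (κ∕4)`, `η = min (κ∕2) (δ∕2)`.  NO charge ∕ moment ∕ gradient row. -/
theorem biLoc_smul_push₃_block (hN : 1 ≤ N)
    (hl : ∀ α x' k x, |l α x' k x| ≤ Cl * Real.exp (-κ * l1 (quo N x - x')))
    (hr : ∀ β z' k z, |r β z' k z| ≤ Cr * Real.exp (-κ * l1 (quo N z - z')))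
    (hw : ∀ ν U k u, |w ν U k u| ≤ Cw * Real.exp (-κ * l1 (quo N u - U)))
    (hS : ∀ k u x z a b, |S k u x z a b| ≤ Cs * ω u * Real.exp (-m' * (l1 (x - u) + l1 (z - u))))
    (hκ : 0 < κ) (hm : κ < m') (hδ : 0 < δ) (hCl : 0 ≤ Cl) (hCr : 0 ≤ Cr) (hCw : 0 ≤ Cw) (hCs : 0 ≤ Cs)
    (y : Fin (d + 1) → ℤ)
    (hω : ∀ u, 0 ≤ ω u ∧ ω u ≤ ∑ μ : Fin (d + 1),
      (∑ v ∈ ((box (d + 1) N).filter (fun v => v μ = N - 1)).image (fun v => (N : ℤ) • y + toSite v), Real.exp (-δ * l1 (v - u))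
        + ∑ v ∈ ((box (d + 1) N).filter (fun v => v μ = 0)).image (fun v => (N : ℤ) • y + toSite v - unitVec μ),
            Real.exp (-δ * l1 (v - u))))
    (c : ℝ) (ν : Fin (d + 1)) (U : Fin (d + 1) → ℤ) :
    BiLoc (c • push₃ l r w S ν U) U U
      (|c| * ((((d : ℝ) + 1) ^ 3 * (Cl * Cr * Cw * Cs) * Zl (d + 1) (m' / 2) ^ 2)
        * ((2 * ((d : ℝ) + 1)) ^ 2 * Zl (d + 1) (δ / 2) * (N : ℝ) ^ d * Real.exp (min (κ / 2) (δ / 2))))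
        * Real.exp (-(min (κ / 2) (δ / 2)) * l1 (y - U))) (κ / 4) := by
  have hm0 : 0 < m' := hκ.trans hm
  have hZ1 : 0 ≤ Zl (d + 1) (m' / 2) := Zl_nonneg (half_pos hm0)
  have hZ2 : 0 ≤ Zl (d + 1) (δ / 2) := Zl_nonneg (half_pos hδ)
  -- the weight is bounded (the `Ω` binder of the weighted entry estimate; it enters no constant)
  set Ω : ℝ := ∑ _μ : Fin (d + 1), (((N ^ d : ℕ) : ℝ) + ((N ^ d : ℕ) : ℝ)) with hΩ
  have hωΩ : ∀ u, 0 ≤ ω u ∧ ω u ≤ Ω := by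
    intro u
    refine ⟨(hω u).1, (hω u).2.trans ?_⟩
    rw [hΩ]
    refine Finset.sum_le_sum fun μ _ => add_le_add ?_ ?_
    · refine (Finset.sum_le_card_nsmul _ _ 1 fun v _ => ?_).trans ?_
      · exact Real.exp_le_one_iff.2 (by nlinarith [l1_nonneg (v - u), hδ.le])
      · rw [nsmul_eq_mul, mul_one]
        exact_mod_cast (card_faces_le hN y μ).1
    · refine (Finset.sum_le_card_nsmul _ _ 1 fun v _ => ?_).trans ?_
      · exact Real.exp_le_one_iff.2 (by nlinarith [l1_nonneg (v - u), hδ.le])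
      · rw [nsmul_eq_mul, mul_one]
        exact_mod_cast (card_faces_le hN y μ).2
  -- the one-block layer count at the kept half-rate `κ∕2`
  have hcount := layerCount_block hN hδ (a := κ / 2) (by linarith) y hω U
  have hcnt0 : 0 ≤ ∑' u, ω u * Real.exp (-(κ / 2) * l1 (quo N u - U)) :=
    tsum_nonneg fun u => mul_nonneg (hω u).1 (Real.exp_pos _).le
  have hmin : min (κ / 2 / 2) (δ / 2) = min (κ / 4) (δ / 2) := by congr 1; ring
  -- ff-support of the scaled push
  have hff : IsFF (c • push₃ l r w S ν U) := by
    have h := isFF_push₃ (l := l) (r := r) (w := w) S ν U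
    exact ⟨fun x z μ b => by show c * push₃ l r w S ν U x z (Sum.inr μ) b = 0; rw [h.1 x z μ b, mul_zero],
      fun x z a ν' => by show c * push₃ l r w S ν U x z a (Sum.inr ν') = 0; rw [h.2 x z a ν', mul_zero]⟩
  refine biLoc_of_isFF hff (by positivity) fun x' z' α β => ?_
  have hpush := abs_push₃_inl_inl_le_weighted (N := N) hN hl hr hw hS hωΩ hκ hm0 hCl hCr hCw hCs ν U x' z' α β
  rw [min_rate_eq hκ hm] at hpush
  show |c * push₃ l r w S ν U x' z' (Sum.inl α) (Sum.inl β)| ≤ _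
  rw [abs_mul]
  have hK0 : 0 ≤ ((d : ℝ) + 1) ^ 3 * (Cl * Cr * Cw * Cs) * Zl (d + 1) (m' / 2) ^ 2 := by positivity
  have he0 : 0 ≤ Real.exp (-(κ / 4) * (l1 (x' - U) + l1 (z' - U))) := (Real.exp_pos _).le
  -- combine: entry estimate × layer count
  have h1 : |push₃ l r w S ν U x' z' (Sum.inl α) (Sum.inl β)|
      ≤ (((d : ℝ) + 1) ^ 3 * (Cl * Cr * Cw * Cs) * Zl (d + 1) (m' / 2) ^ 2)
          * Real.exp (-(κ / 4) * (l1 (x' - U) + l1 (z' - U)))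
          * ((2 * ((d : ℝ) + 1)) ^ 2 * Zl (d + 1) (δ / 2) * (N : ℝ) ^ d
              * (Real.exp (min (κ / 2) (δ / 2)) * Real.exp (-(min (κ / 2) (δ / 2)) * l1 (y - U)))) :=
    hpush.trans (mul_le_mul_of_nonneg_left hcount (mul_nonneg hK0 he0))
  refine (mul_le_mul_of_nonneg_left h1 (abs_nonneg c)).trans (le_of_eq ?_)
  ring

end Block

/-! ## §3 `d = 3`: the literal's `hLT` at depth zero, for every sub-letter -/

section Three

variable {Lc : ℕ} [NeZero Lc]

/-- NOT IN PRINT; OUR BOOKKEEPING (§2 ⨾ leaf-12's `DressedLegEnvelope.exists_legChain_envelope` at the pair `(m+1, 0)` ⨾ §1).  **THE LITERAL's LAYER BOUND AT DEPTH ZERO, FOR EVERY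
SUB-LETTER.**  `d = 3`, `2 ≤ Lc`, in-block root `toSite rr`: there are `κ₀′ > 0`, `K′ ≥ 0` (level-free) such that for every `m`, every `0 < κ ≤ κ₀′`, every letter `S` under the END's (LAY)
rows at blocking `Lc^(0+1)` and block label `y` — `|S κ′ u x z a b| ≤ Cs·ω u·e^{−m′(‖x−u‖₁+‖z−u‖₁)}` (`κ < m′`, `0 ≤ Cs`), `ω` under the face weight of the `Lc^(0+1)`-block of `y` (`0 < δ`) — and
every output slot `(ν, U)`, the DRESSED cubic push at depth zero, `T₀ = legChain (respStepBmSeq ρ Lc) (m+1) 0`, satisfies the END's displayed `hLT` at `k = 0` in its own currency: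
`BiLoc ((Lc^(0+1))^{3(3+1)} • push₃ T₀ T₀ T₀ S ν U) U U ((K′·Cs·Zl(m′∕2)²·Zl(δ∕2)·e^{min(κ∕2,δ∕2)})·((√(Lc^(0+1)))⁻¹·e^{−min(κ∕2,δ∕2)‖y − U‖₁})) (κ∕4)`.
No gauge cell, no charge ∕ moment row: at depth zero there is no large parameter.  (So `WardRemainderEndThreeCoDress`'s good set may contain `m + 2 = n` for EVERY `v`.) -/
theorem exists_hLT_literal_depth_zero (hLc : 2 ≤ Lc) {rr : Fin (3 + 1) → ℕ} (hrr : rr ∈ box (3 + 1) Lc) :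
    ∃ κ₀' K' : ℝ, 0 < κ₀' ∧ 0 ≤ K' ∧
      ∀ (m : ℕ) (κ : ℝ), 0 < κ → κ ≤ κ₀' →
      ∀ (S : Fin (3 + 1) → (Fin (3 + 1) → ℤ) → MKer (3 + 1) (Fib 3)) (ω : (Fin (3 + 1) → ℤ) → ℝ) (Cs m' δ : ℝ),
        κ < m' → 0 < δ → 0 ≤ Cs →
        (∀ k' u x z a b, |S k' u x z a b| ≤ Cs * ω u * Real.exp (-m' * (l1 (x - u) + l1 (z - u)))) →
        ∀ (y : Fin (3 + 1) → ℤ),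
        (∀ u, 0 ≤ ω u ∧ ω u ≤ ∑ μ : Fin (3 + 1),
          (∑ v ∈ ((box (3 + 1) (Lc ^ (0 + 1))).filter (fun v => v μ = Lc ^ (0 + 1) - 1)).image (fun v => ((Lc ^ (0 + 1) : ℕ) : ℤ) • y + toSite v),
              Real.exp (-δ * l1 (v - u))
            + ∑ v ∈ ((box (3 + 1) (Lc ^ (0 + 1))).filter (fun v => v μ = 0)).image (fun v => ((Lc ^ (0 + 1) : ℕ) : ℤ) • y + toSite v - unitVec μ),
                Real.exp (-δ * l1 (v - u)))) →
        ∀ (ν : Fin (3 + 1)) (U : Fin (3 + 1) → ℤ),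
        BiLoc (((((Lc ^ (0 + 1) : ℕ) : ℝ)) ^ (3 * (3 + 1))) •
            push₃ (legChain (respStepBmSeq (d := 3) (toSite rr) Lc) (m + 1) 0) (legChain (respStepBmSeq (d := 3) (toSite rr) Lc) (m + 1) 0)
              (legChain (respStepBmSeq (d := 3) (toSite rr) Lc) (m + 1) 0) S ν U) U U
          ((K' * Cs * Zl (3 + 1) (m' / 2) ^ 2 * Zl (3 + 1) (δ / 2) * Real.exp (min (κ / 2) (δ / 2)))
            * ((Real.sqrt (((Lc ^ (0 + 1) : ℕ) : ℝ)))⁻¹ * Real.exp (-(min (κ / 2) (δ / 2)) * l1 (y - U)))) (κ / 4) := by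
  obtain ⟨κ₁, KT, hκ₁, hKT, hT⟩ := exists_legChain_envelope (Lc := Lc) hLc
  -- the blocking at depth zero and its real size
  set N : ℕ := Lc ^ (0 + 1) with hN
  have hLc1 : 1 ≤ Lc := le_trans (by norm_num) hLc
  have hN1 : 1 ≤ N := Nat.one_le_pow _ _ hLc1
  have hN0 : (0 : ℝ) < (N : ℝ) := by exact_mod_cast hN1
  have hsq : 0 < Real.sqrt (N : ℝ) := Real.sqrt_pos.2 hN0
  -- the leg constant at depth zero: `KT·(Lc^{4·(0+1)})⁻¹`
  set CL : ℝ := KT * ((Lc : ℝ) ^ (4 * (0 + 1)))⁻¹ with hCL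
  have hCL0 : 0 ≤ CL := by rw [hCL]; positivity
  refine ⟨κ₁ / ((3 : ℝ) + 1), (N : ℝ) ^ (3 * (3 + 1)) * ((((3 : ℝ) + 1) ^ 3 * (CL * CL * CL)) * ((2 * ((3 : ℝ) + 1)) ^ 2 * (N : ℝ) ^ 3)) * Real.sqrt (N : ℝ),
    by positivity, by positivity, ?_⟩
  intro m κ hκ hκκ S ω Cs m' δ hm hδ hCs hS y hω ν U
  -- the dressed legs at `(m+1, 0)` meet the coarse `ℓ¹`-rate-`κ` sup-envelope with constant `CL`
  have hrate : ((3 : ℝ) + 1) * κ ≤ κ₁ := by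
    have h4 : (0 : ℝ) < (3 : ℝ) + 1 := by norm_num
    calc ((3 : ℝ) + 1) * κ ≤ ((3 : ℝ) + 1) * (κ₁ / ((3 : ℝ) + 1)) := mul_le_mul_of_nonneg_left hκκ h4.le
      _ = κ₁ := by field_simp
  have hleg : ∀ μ z κ' u, |legChain (respStepBmSeq (d := 3) (toSite rr) Lc) (m + 1) 0 μ z κ' u| ≤ CL * Real.exp (-κ * l1 (quo N u - z)) := by
    intro μ z κ' u
    refine (hT rr hrr (m + 1) 0 μ z κ' u).trans ?_
    rw [hCL]
    exact mul_le_mul_of_nonneg_left (exp_supNorm_le_exp_l1 (d := 3) hκ.le hrate _) (by positivity)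
  have h := biLoc_smul_push₃_block (d := 3) (N := N) hN1 hleg hleg hleg hS hκ hm hδ hCL0 hCL0 hCL0 hCs y hω
    ((((N : ℕ) : ℝ)) ^ (3 * (3 + 1))) ν U
  refine biLoc_weaken h (le_of_eq ?_) le_rfl
  -- the two constants agree (`√N·(√N)⁻¹ = 1`, `|N^{12}| = N^{12}`)
  have e1 : Real.sqrt (N : ℝ) * (Real.sqrt (N : ℝ))⁻¹ = 1 := mul_inv_cancel₀ hsq.ne'
  have e3 : ((3 : ℕ) : ℝ) = (3 : ℝ) := by norm_num
  rw [abs_of_nonneg (by positivity : (0 : ℝ) ≤ ((N : ℕ) : ℝ) ^ (3 * (3 + 1))), e3]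
  calc ((N : ℝ)) ^ (3 * (3 + 1)) * ((((3 : ℝ) + 1) ^ 3 * (CL * CL * CL * Cs) * Zl (3 + 1) (m' / 2) ^ 2)
        * ((2 * ((3 : ℝ) + 1)) ^ 2 * Zl (3 + 1) (δ / 2) * (N : ℝ) ^ 3 * Real.exp (min (κ / 2) (δ / 2))))
        * Real.exp (-(min (κ / 2) (δ / 2)) * l1 (y - U))
      = ((N : ℝ)) ^ (3 * (3 + 1)) * ((((3 : ℝ) + 1) ^ 3 * (CL * CL * CL * Cs) * Zl (3 + 1) (m' / 2) ^ 2)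
        * ((2 * ((3 : ℝ) + 1)) ^ 2 * Zl (3 + 1) (δ / 2) * (N : ℝ) ^ 3 * Real.exp (min (κ / 2) (δ / 2))))
        * (Real.sqrt (N : ℝ) * (Real.sqrt (N : ℝ))⁻¹) * Real.exp (-(min (κ / 2) (δ / 2)) * l1 (y - U)) := by rw [e1, mul_one]
    _ = ((N : ℝ) ^ (3 * (3 + 1)) * ((((3 : ℝ) + 1) ^ 3 * (CL * CL * CL)) * ((2 * ((3 : ℝ) + 1)) ^ 2 * (N : ℝ) ^ 3)) * Real.sqrt (N : ℝ)
          * Cs * Zl (3 + 1) (m' / 2) ^ 2 * Zl (3 + 1) (δ / 2) * Real.exp (min (κ / 2) (δ / 2)))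
        * ((Real.sqrt (N : ℝ))⁻¹ * Real.exp (-(min (κ / 2) (δ / 2)) * l1 (y - U))) := by ring

end Three

end Summit.QuantumFields.BalabanUV.Beta.GAN24.LayerTransportDepthZero

end
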